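import Summits.ResolutionOfSingularities.ResolutionOfSingularities.Theorems.OddCrossCutKernels
import HarnessLib

/-!
# OddCrossCutKernels2 — decomp-res node «OddCrossCut» (lens-2 g23), file 2/2 of `OddCrossCutKernels`

Content VERBATIM from the decomp-res lens-2 g23 node `HOME/decomp-res-lens-2/g23/OddCrossCut.lean` (pin aae59dc8, 6
388 l; HOME = run/shared/lean/pub/decomp-res); CRITIC-LEDGER row 184 CLEARED ((X***) `OddCrossExit`
DECIDED-MOD-PORT(M+) +1 · MAP 0: residue-characteristic ≠ 2 deep crosses typed as a CLASS WITH TAILS + the odd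
guard; exit package decided on paper to cn27 standard by ODD DOMINATION; exact re-location of `IsDeepSpecialPt`);
landing orders NEXT-g24 §Landing + critic rider INBOX :970: ONLY the NEW part §Z (node lines 5511–6388) is landed —
the node's CARRIED copies of g14–g22 (lines 306–4942, 4991–5507; ns `…Theses.OddCrossCut`) are NOT landed
(DELETE-on-landing: they ARE the tree modules
PinchCut/JetCut/PurityCut/SplitCut/CylinderCut/SpreadCut/CrossCut/DeepCrossCut*, opened here instead); namespace
`…Theses.OddCrossCut` ↦ `…Theorems.OddCrossCut`; all files `--kind proof --supports
stmt-ResolutionOfSingularities-29273` (the ring-kernel file as helper).  Farm (node, critic re-farm): rc 0 · 0 err ·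
0 warn · 0 sorry · axioms std.

§Z.0 (NEW, ring level; `section OddRing` / `OddInhabitant` / `OddCorner`) — the ODD READING in kernel: the guard
functionals `deltaFun` / `deltaFunC` (`dvd_two_of_dvd_deltaFun`, `dvd_of_dvd_deltaFunC`,
`deltaFun_hray(_neighbour)`), the cross-term lemma `crossTerm_coeff`, tails and pairs (`tail_deg_ge_three(_line)`,
`IsPairZ`, `oddReading_*`, `oddSpecial_*`, `tail_ne_pair`, `deltaFun_not_zero_on_basis`); the 𝔽₃ INHABITANT of
window (d‴) at ring level (`oddX3f/g`, `oddX3`, `deepFrame3`, `represent_*`, `deepCrossNewtShape_oddX3`,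
`oddX3_le_sq_*`, `ringChar_zmod_three`, `oddGuard_*`); §Z.0c the CORNER CERTIFICATE `corner39_*` (the doubly
divisible complement of the odd guard IS inhabited and 𝒫(3,9) does not exit there), `pairTail_le_pairWt`,
`three_eq_zero_of_charP`.  Over the tree's `DeepCrossCutKernels2` (`deepWt` / `deepNewt` / `pairWt`, `monomial_mem_*`).

Part 2/2 carries: `oddX3g`, `oddX3`, `deepFrame3`, `represent_oddX3f`, `represent_oddX3g`, `oddX3g_mem_deepNewt`,
`deepCrossNewtShape_oddX3`, `oddX3_le_sq_steep`, `oddX3_le_sq_flat`, `ringChar_zmod_three`,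
`oddGuard_two_seven_at_three`, `oddGuard_fails_one_nine_at_three`, `corner39_tail_mem_deepTail`,
`corner39_deepCrossNewtShape`, `corner39_tail_mem_pairTail`, `corner39_terms_mem_pairWt`, `pairTail_le_pairWt`,
`corner39_steepPairShape`, `corner39_chart`, `corner39_initialForm`, `three_eq_zero_of_charP`.

(Sources: Hironaka1964 Ch. III; CossartJannsenSaito2020 Ch. 2, Ch. 8–9; CossartPiltant2008 Prop. 4.2;
CossartPiltant2019 Rem. 3.2; BierstoneGrigorievMilmanWlodarczyk2011 §3.1; Moh1987; Hauser2010Kangaroo; Giraud1975;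
Narasimhan1983.)
-/

open CategoryTheory AlgebraicGeometry TopologicalSpace IsLocalRing
open Literature.AlgebraicGeometry.Resolution
open Summit.ResolutionOfSingularities.ResolutionOfSingularities.Theorems
open Summit.ResolutionOfSingularities.ResolutionOfSingularities.Theorems.WeakOrderReduction
open Summit.ResolutionOfSingularities.ResolutionOfSingularities.Theorems.DeltaFaceCutClasses
open Summit.ResolutionOfSingularities.ResolutionOfSingularities.Theorems.RelativeDeltaCut
open Summit.ResolutionOfSingularities.ResolutionOfSingularities.Theorems.CurveLeafExit
open Summit.ResolutionOfSingularities.ResolutionOfSingularities.Theorems.DeepCrossCut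
open Summit.ResolutionOfSingularities.ResolutionOfSingularities.Theorems.PinchCut
open Summit.ResolutionOfSingularities.ResolutionOfSingularities.Theorems.JetCut
open Summit.ResolutionOfSingularities.ResolutionOfSingularities.Theorems.PurityCut
open Summit.ResolutionOfSingularities.ResolutionOfSingularities.Theorems.SplitCut
open Summit.ResolutionOfSingularities.ResolutionOfSingularities.Theorems.CylinderCut
open Summit.ResolutionOfSingularities.ResolutionOfSingularities.Theorems.SpreadCut
open Summit.ResolutionOfSingularities.ResolutionOfSingularities.Theorems.CrossCut
open Summit.ResolutionOfSingularities.ResolutionOfSingularities.Theorems.DeepCrossCut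
open MvPolynomial

namespace Summit.ResolutionOfSingularities.ResolutionOfSingularities.Theorems.OddCrossCut

section OddRing

variable {R : Type} [CommRing R]

section OddInhabitant

open MvPolynomial

/-- The second generator `v²·u₂⁸` (it makes `τ = 2` along the flat branch off the tangle and keeps `I` in the Newton
member ideal; with it
`I` is NOT principal).  DEFINITION (support). [folklore] -/
noncomputable def oddX3g : MvPolynomial (Fin 4) (ZMod 3) := X 3 ^ 2 * X 2 ^ 8

/-- **THE `𝔽₃` DATUM `I = (z² + u₁⁵ + v²u₂⁷, v²u₂⁸)` on `𝔸⁴_{𝔽₃}`** [critic row 175 (certified there: `T =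
V(z,u₁,u₂) ∪ V(z,u₁,v)` is the
order-`2` locus near `T`, clopen; residue fields of characteristic `3` along `T`; deep letter at the origin with `ε₁
= ε₂ = 1`, `g = 0`;
steep-pair letters along `C₁ ∖ 0`; flank letter at `(0,0,c,0)`, `c ≠ 0`, with member `f − c⁷(1 + w)⁻¹·(v²u₂⁸) = z² + μv² + u₁⁵`,
`μ = −c⁸ w (1+w)⁻¹`, `u₂ = c(1+w)`, a UNIFORMISER; `(q, d) = (2, 7)`, `gcd(5, 7) = 1`, so the ODD GUARD holds: `3 ∤
2`)].  DEFINITION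
(support, the inhabitant's ideal at the ring level). [folklore] -/
noncomputable def oddX3 : Ideal (MvPolynomial (Fin 4) (ZMod 3)) := Ideal.span {oddX3f, oddX3g}

/-- The coordinate frame `(z, u₁, u₂, v)` of `𝔸⁴_{𝔽₃}`.  DEFINITION (support). [folklore] -/
noncomputable def deepFrame3 : Fin 4 → MvPolynomial (Fin 4) (ZMod 3) := ![X 0, X 1, X 2, X 3]

/-- `f₃` in deep-cross presentation: corner `z²`, `ε₁ = ε₂ = 1`, `q = 2`, `d = 7`, NO tail.  KERNEL (PROVED). [folklore] -/
theorem represent_oddX3f :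
    oddX3f = deepFrame3 0 ^ 2 + 1 * deepFrame3 1 ^ (2 * 2 + 1) + 1 * deepFrame3 3 ^ 2 * deepFrame3 2 ^ 7 + 0 := by
  simp only [oddX3f, deepFrame3, Matrix.cons_val_zero, Matrix.cons_val_one, Matrix.head_cons, Matrix.cons_val_two,
    Matrix.tail_cons, Matrix.cons_val_three]
  ring

/-- The second generator as a frame monomial `z⁰u₁⁰u₂⁸v²`.  KERNEL (PROVED). [folklore] -/
theorem represent_oddX3g : oddX3g = deepFrame3 0 ^ 0 * deepFrame3 1 ^ 0 * deepFrame3 2 ^ 8 * deepFrame3 3 ^ 2 := by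
  simp only [oddX3g, deepFrame3, Matrix.cons_val_zero, Matrix.cons_val_one, Matrix.head_cons, Matrix.cons_val_two,
    Matrix.tail_cons, Matrix.cons_val_three]
  ring

/-- `v²u₂⁸` lies in the Newton member ideal `deepNewt (q,d) = (2,7)`: weights `W₁ = 16 ≥ 10`, `W₂ = 4 ≥ 4`, `W₃ = 80
≥ 70`, `W₂′ = 10 ≥ 10`.
KERNEL (PROVED). [folklore] -/
theorem oddX3g_mem_deepNewt : oddX3g ∈ deepNewt deepFrame3 2 7 := by
  rw [represent_oddX3g]
  exact monomial_mem_deepNewt deepFrame3 2 7 0 0 8 2 (by norm_num) (by norm_num) (by norm_num) (by norm_num)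

/-- **THE NEWTON-TYPED DEEP-CROSS LETTER HOLDS FOR THE `𝔽₃` DATUM AT THE RING LEVEL** [g23; KERNEL (PROVED)]: `J =
(f₃, v²u₂⁸)`, the
coordinate frame, `q = 2`, `d = 7`: units `1, 1`, tail `0`, BOTH generators in the Newton member ideal.  CERTIFICATE
of the inhabitant's
tangle letter (the scheme-level clauses: critic row 175, restated in the docstring of `oddX3`). [folklore] -/
theorem deepCrossNewtShape_oddX3 : DeepCrossNewtShape oddX3 deepFrame3 2 7 := by
  refine ⟨1, 1, 0, isUnit_one, isUnit_one, Ideal.zero_mem _, ?_, ?_⟩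
  · rw [← represent_oddX3f]
    exact Ideal.subset_span (by simp)
  · rw [oddX3, Ideal.span_le]
    rintro x hx
    simp only [Set.mem_insert_iff, Set.mem_singleton_iff] at hx
    rcases hx with rfl | rfl
    · rw [represent_oddX3f, add_zero]
      exact deep_terms_mem_deepNewt deepFrame3 1 1 2 7 (by norm_num)
    · exact oddX3g_mem_deepNewt

/-- Both generators lie in the SQUARE of the prime `(z, u₁, u₂)` of the steep branch (order `≥ 2` along `C₁` at the
ring level) …
KERNEL (PROVED). [folklore] -/
theorem oddX3_le_sq_steep :
    oddX3 ≤ (Ideal.span {deepFrame3 0, deepFrame3 1, deepFrame3 2} : Ideal (MvPolynomial (Fin 4) (ZMod 3))) ^ 2 := by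
  have h0 : deepFrame3 0 ∈ (Ideal.span {deepFrame3 0, deepFrame3 1, deepFrame3 2} :
      Ideal (MvPolynomial (Fin 4) (ZMod 3))) := Ideal.subset_span (by simp)
  have h1 : deepFrame3 1 ∈ (Ideal.span {deepFrame3 0, deepFrame3 1, deepFrame3 2} :
      Ideal (MvPolynomial (Fin 4) (ZMod 3))) := Ideal.subset_span (by simp)
  have h2 : deepFrame3 2 ∈ (Ideal.span {deepFrame3 0, deepFrame3 1, deepFrame3 2} :
      Ideal (MvPolynomial (Fin 4) (ZMod 3))) := Ideal.subset_span (by simp)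
  rw [oddX3, Ideal.span_le]
  rintro x hx
  simp only [Set.mem_insert_iff, Set.mem_singleton_iff] at hx
  rcases hx with rfl | rfl
  · rw [represent_oddX3f]
    refine Ideal.add_mem _ (Ideal.add_mem _ (Ideal.add_mem _ ?_ ?_) ?_) (Ideal.zero_mem _)
    · exact Ideal.pow_mem_pow h0 2
    · rw [show (1 : MvPolynomial (Fin 4) (ZMod 3)) * deepFrame3 1 ^ (2 * 2 + 1) = deepFrame3 1 ^ 3 * deepFrame3 1 ^ 2 by ring]
      exact Ideal.mul_mem_left _ _ (Ideal.pow_mem_pow h1 2)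
    · rw [show (1 : MvPolynomial (Fin 4) (ZMod 3)) * deepFrame3 3 ^ 2 * deepFrame3 2 ^ 7 =
          (deepFrame3 3 ^ 2 * deepFrame3 2 ^ 5) * deepFrame3 2 ^ 2 by ring]
      exact Ideal.mul_mem_left _ _ (Ideal.pow_mem_pow h2 2)
  · rw [represent_oddX3g, show deepFrame3 0 ^ 0 * deepFrame3 1 ^ 0 * deepFrame3 2 ^ 8 * deepFrame3 3 ^ 2 =
        (deepFrame3 3 ^ 2 * deepFrame3 2 ^ 6) * deepFrame3 2 ^ 2 by ring]
    exact Ideal.mul_mem_left _ _ (Ideal.pow_mem_pow h2 2)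

/-- … and in the SQUARE of the prime `(z, u₁, v)` of the flat branch.  KERNEL (PROVED). [folklore] -/
theorem oddX3_le_sq_flat :
    oddX3 ≤ (Ideal.span {deepFrame3 0, deepFrame3 1, deepFrame3 3} : Ideal (MvPolynomial (Fin 4) (ZMod 3))) ^ 2 := by
  have h0 : deepFrame3 0 ∈ (Ideal.span {deepFrame3 0, deepFrame3 1, deepFrame3 3} :
      Ideal (MvPolynomial (Fin 4) (ZMod 3))) := Ideal.subset_span (by simp)
  have h1 : deepFrame3 1 ∈ (Ideal.span {deepFrame3 0, deepFrame3 1, deepFrame3 3} :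
      Ideal (MvPolynomial (Fin 4) (ZMod 3))) := Ideal.subset_span (by simp)
  have h3 : deepFrame3 3 ∈ (Ideal.span {deepFrame3 0, deepFrame3 1, deepFrame3 3} :
      Ideal (MvPolynomial (Fin 4) (ZMod 3))) := Ideal.subset_span (by simp)
  rw [oddX3, Ideal.span_le]
  rintro x hx
  simp only [Set.mem_insert_iff, Set.mem_singleton_iff] at hx
  rcases hx with rfl | rfl
  · rw [represent_oddX3f]
    refine Ideal.add_mem _ (Ideal.add_mem _ (Ideal.add_mem _ ?_ ?_) ?_) (Ideal.zero_mem _)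
    · exact Ideal.pow_mem_pow h0 2
    · rw [show (1 : MvPolynomial (Fin 4) (ZMod 3)) * deepFrame3 1 ^ (2 * 2 + 1) = deepFrame3 1 ^ 3 * deepFrame3 1 ^ 2 by ring]
      exact Ideal.mul_mem_left _ _ (Ideal.pow_mem_pow h1 2)
    · rw [show (1 : MvPolynomial (Fin 4) (ZMod 3)) * deepFrame3 3 ^ 2 * deepFrame3 2 ^ 7 =
          deepFrame3 2 ^ 7 * deepFrame3 3 ^ 2 by ring]
      exact Ideal.mul_mem_left _ _ (Ideal.pow_mem_pow h3 2)
  · rw [represent_oddX3g, show deepFrame3 0 ^ 0 * deepFrame3 1 ^ 0 * deepFrame3 2 ^ 8 * deepFrame3 3 ^ 2 =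
        deepFrame3 2 ^ 8 * deepFrame3 3 ^ 2 by ring]
    exact Ideal.mul_mem_left _ _ (Ideal.pow_mem_pow h3 2)

/-- The residue characteristic of the datum's base: `ringChar 𝔽₃ = 3`.  KERNEL (PROVED). [folklore] -/
theorem ringChar_zmod_three : ringChar (ZMod 3) = 3 := ZMod.ringChar_zmod_n 3

/-- **THE ODD GUARD HOLDS FOR THE `𝔽₃` DATUM** (`(q,d) = (2,7)`: `3 ∤ 2·gcd(5,7) = 2`).  KERNEL (PROVED, `decide`).
[folklore] -/
theorem oddGuard_two_seven_at_three : ¬ (3 ∣ 2 * Nat.gcd (2 * 2 + 1) 7) := by decide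

/-- … and FAILS, honestly, for `(q, d) = (1, 9)` in residue characteristic `3` (`3 ∣ gcd(3, 9)`): such deep crosses
stay in the located
residual (§Z.1 GUARD) — and they EXIST, with the transported package failing to exit: the corner member `corner39`
of §Z.0c.  KERNEL (PROVED,
`decide`). [folklore] -/
theorem oddGuard_fails_one_nine_at_three : 3 ∣ 2 * Nat.gcd (2 * 1 + 1) 9 := by decide

end OddInhabitant

section OddCorner

/-! #### §Z.0c  THE CORNER CERTIFICATE — the doubly divisible complement of the odd guard IS INHABITED, and the
transported package
𝒫(m,d) does NOT exit there (so the second half of the guard is NECESSARY for ODD DOMINATION, not an artefact of its proof).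
MEMBER `corner39`: `p = 3`, `(q,d) = (1,9)` (`m = 3`, `g = gcd(3,9) = 3 = p`, `oddGuard_fails_one_nine_at_three`),
`Y` = the SEMILOCAL scheme of
`𝔸⁴_{𝔽₃} = Spec 𝔽₃[z,x,y,t]` at the two closed points `y₀ = 0` (the tangle) and `y′ = (0,0,0,1) ∈ C₁ ∖ C₂` (no
closed point on `C₂ ∖ C₁`:
the flank clause is vacuous, as for every principal member in odd characteristic), `I = (f)`,
`f = z² + (x + 2t + 2)·x³ + t²·y⁹ + x²y⁴t + x³yt`, `C₁ = V(z,x,y)`, `C₂ = V(z,x,t)`, frame `(z,u₁,u₂,v) = (z,x,y,t)`.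
CLAUSES (paper, each a short check): `f ∈ (z,x,y)² ∩ (z,x,t)²`, order exactly `2` along `T` (the corner `z²`); «`T`
open in Top» holds on
all of `𝔸⁴_{𝔽₃}`: with `∂_z f = 2z`, `∂_x f = x(x² + 2ty⁴)`, `∂_y f = x²t(y³ + x)`, `∂_t f = 2x³ + 2ty⁹ + x²y⁴ +
x³y` (characteristic `3`)
the system `f = ∇f = 0` forces `z = 0` and — `x = 0`: `t²y⁹ = 0`, i.e. `C₁ ∪ C₂`; `t = 0 ≠ x`: `x³ = 0`, absurd; `x
= −y³ ≠ 0 ≠ t`: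
`t = y²`, then `∂_t f = 2y⁹(y² − 1)` gives `y = ±1`, `t = 1`, `x = ∓1`, where `f = 1 ≠ 0` — so `V(f, ∇f) = C₁ ∪ C₂`
over `𝔽̄₃`; the deep
letter `(1,9)` at `y₀` with units `ε₁ = x + 2t + 2`, `ε₂ = 1` and tail `x²y⁴t + x³yt` (weights `(12,3,60)`,
`(8,4,60)` against the strict
thresholds `(7,3,55)`): `corner39_deepCrossNewtShape`; the steep-pair letter `(3,9)` at `y′` with units `ε₁`, `ε₃ = t²` and tail
`t·x²y⁴ + t·x³y` (weights `(12,60)`, `(8,60)` against `(7,55)`): `corner39_steepPairShape`; residue characteristic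
`3` along `T`; `Y` regular.
THE RUN OVER `y′`: the centres of 𝒫(3,9) dominating `C₁` are `C₁`, the section `{r, e_x}` (`r = (1,1,0)`), the
section `{s, e_x}`
(`s = (2,1,0)`), creating the `H`-ray `v = (3,1,0) = (d′,m′,0)` of type `(1,1)` (g21 `combi.py`, `Game(3,9)`:
history `P2 C₁ → r`,
`P2 {e_x,r} → s`, `P1 s`, `P2 {e_x,s} → v`, `P2 C₂`; the last centre lies over `t = 0` and does not meet the fibre
of `y′`); cumulative chart of
the cone `{v, e_x}`: `x = u³w`, `y = u`, `z = Z·u⁴` (`u = u_v`, `w = u_{e_x}`, `c_v = 8`): `corner39_chart` — `f = u⁸·F`,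
`F = Z² + u·((2t+2)w³ + t²) + u²·(w²t + w³t) + u⁴w⁴`.  THE BAD POINT `P = (Z,u,w,t) = (0,0,2,1) ∈ E_v` over `y′`:
`Γ_v = {(2t+2)w³ + t² = 0}`
passes through `P` (`1·8 + 1 = 9 = 0`) with vanishing differential there (`3(2t+2)w²dw = 0`, `(2w³ + 2t)dt = 18dt =
0`: the unit ratio
`ρ = ε₁/t²` restricted to `C₁` has `(log ρ)′(1) = 2/1 − 2/1 = 0`, §Z.1 (d)), and in the centred coordinates `w = 2 +
W`, `t = 1 + T`:
`F = Z² + u(T² + W³ + 2TW³) + u²·W(1+T)(2+W)² + u⁴(2+W)⁴` (`corner39_initialForm`, using `3 = 0`) — every monomial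
but `Z²` has degree
`≥ 3`, so `ord_P(I𝒪_{X₄}) = 2 = max` and the INITIAL FORM IS `Z²`: `τ(P) = 1`, `P` lies over `T` —
`PackageExitsOver` FAILS for the
transported 𝒫(3,9) at this member (the tail `x³yt` is what tunes the `u²`-coefficient `w²t + w³t = w²t(1 + w)` to
vanish at `w = 2`; without
it `τ(P) = 2`).  WHAT THIS DOES NOT SAY: that no OTHER package exits for `corner39` (one chart of the blow-up of `P`
shows a new `τ = 1` point on
`E_P ∩ E_v′` — an E**-type residual-exit problem, booked as window candidate (α) of NEXT-g24); the class (d‴) is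
untouched: `corner39` violates
the odd guard and is a point of the located residual `IsOddSpecialPt`. -/

/-- The corner member's TAIL `l₁·x²y⁴t + l₂·x³yt` lies in the strict deep tail ideal of `(q,d) = (1,9)` (weights
`(12,3,60)` and `(8,4,60)`
against the thresholds `(7,3,55)`).  KERNEL (PROVED). [folklore] -/
theorem corner39_tail_mem_deepTail (c : Fin 4 → R) (l₁ l₂ : R) :
    l₁ * (c 1 ^ 2 * c 2 ^ 4 * c 3) + l₂ * (c 1 ^ 3 * c 2 * c 3) ∈
      deepWt c 1 9 (2 * (2 * 1 + 1) + 1) (2 * 1 + 1) (2 * (2 * 1 + 1) * 9 + 1) := by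
  refine Ideal.add_mem _ ?_ ?_
  · have h := monomial_mem_deepWt c 1 9 (2 * (2 * 1 + 1) + 1) (2 * 1 + 1) (2 * (2 * 1 + 1) * 9 + 1) 0 2 4 1
      (by norm_num) (by norm_num) (by norm_num)
    have h' : l₁ * (c 1 ^ 2 * c 2 ^ 4 * c 3) = l₁ * (c 0 ^ 0 * c 1 ^ 2 * c 2 ^ 4 * c 3 ^ 1) := by ring
    rw [h']; exact Ideal.mul_mem_left _ _ h
  · have h := monomial_mem_deepWt c 1 9 (2 * (2 * 1 + 1) + 1) (2 * 1 + 1) (2 * (2 * 1 + 1) * 9 + 1) 0 3 1 1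
      (by norm_num) (by norm_num) (by norm_num)
    have h' : l₂ * (c 1 ^ 3 * c 2 * c 3) = l₂ * (c 0 ^ 0 * c 1 ^ 3 * c 2 ^ 1 * c 3 ^ 1) := by ring
    rw [h']; exact Ideal.mul_mem_left _ _ h

/-- **THE CORNER MEMBER HAS THE NEWTON-TYPED DEEP LETTER `(q,d) = (1,9)` AT ITS TANGLE** (ring level, any units `e₁,
e₂`, any tail
coefficients `l₁, l₂` — at `y₀`: `e₁ = x + 2t + 2`, `e₂ = 1`, `l₁ = l₂ = 1`).  KERNEL (PROVED). [folklore] -/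
theorem corner39_deepCrossNewtShape (c : Fin 4 → R) (e₁ e₂ l₁ l₂ : R) (he₁ : IsUnit e₁) (he₂ : IsUnit e₂) :
    DeepCrossNewtShape (Ideal.span {c 0 ^ 2 + e₁ * c 1 ^ (2 * 1 + 1) + e₂ * c 3 ^ 2 * c 2 ^ 9 +
      (l₁ * (c 1 ^ 2 * c 2 ^ 4 * c 3) + l₂ * (c 1 ^ 3 * c 2 * c 3))}) c 1 9 := by
  refine ⟨e₁, e₂, _, he₁, he₂, corner39_tail_mem_deepTail c l₁ l₂, Ideal.subset_span (by simp), ?_⟩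
  rw [Ideal.span_le, Set.singleton_subset_iff]
  exact Ideal.add_mem _ (deep_terms_mem_deepNewt c e₁ e₂ 1 9 (by norm_num))
    (deepTail_le_deepNewt c 1 9 (corner39_tail_mem_deepTail c l₁ l₂))

/-- The corner member's tail read in the steep-pair frame at `y′` (`t` a unit): `l₁·x²y⁴ + l₂·x³y` lies in the
strict pair tail ideal of
`(m,d) = (3,9)` (weights `(12,60)`, `(8,60)` against `(7,55)`).  KERNEL (PROVED). [folklore] -/
theorem corner39_tail_mem_pairTail (c : Fin 4 → R) (l₁ l₂ : R) :
    l₁ * (c 1 ^ 2 * c 2 ^ 4) + l₂ * (c 1 ^ 3 * c 2) ∈ pairWt c 3 9 (2 * 3 + 1) (2 * 3 * 9 + 1) := by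
  refine Ideal.add_mem _ ?_ ?_
  · have h := monomial_mem_pairWt c 3 9 (2 * 3 + 1) (2 * 3 * 9 + 1) 0 2 4 (by norm_num) (by norm_num)
    have h' : l₁ * (c 1 ^ 2 * c 2 ^ 4) = l₁ * (c 0 ^ 0 * c 1 ^ 2 * c 2 ^ 4) := by ring
    rw [h']; exact Ideal.mul_mem_left _ _ h
  · have h := monomial_mem_pairWt c 3 9 (2 * 3 + 1) (2 * 3 * 9 + 1) 0 3 1 (by norm_num) (by norm_num)
    have h' : l₂ * (c 1 ^ 3 * c 2) = l₂ * (c 0 ^ 0 * c 1 ^ 3 * c 2 ^ 1) := by ring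
    rw [h']; exact Ideal.mul_mem_left _ _ h

/-- The displayed steep-pair terms `z² + e₁x³ + e₃y⁹` lie in the pair member ideal of `(3,9)`.  KERNEL (PROVED). [folklore] -/
theorem corner39_terms_mem_pairWt (c : Fin 4 → R) (e₁ e₃ : R) :
    c 0 ^ 2 + e₁ * c 1 ^ 3 + e₃ * c 2 ^ 9 ∈ pairWt c 3 9 (2 * 3) (2 * 3 * 9) := by
  refine Ideal.add_mem _ (Ideal.add_mem _ ?_ ?_) ?_
  · have h := monomial_mem_pairWt c 3 9 (2 * 3) (2 * 3 * 9) 2 0 0 (by norm_num) (by norm_num)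
    simpa using h
  · have h := monomial_mem_pairWt c 3 9 (2 * 3) (2 * 3 * 9) 0 3 0 (by norm_num) (by norm_num)
    have h' : e₁ * c 1 ^ 3 = e₁ * (c 0 ^ 0 * c 1 ^ 3 * c 2 ^ 0) := by ring
    rw [h']; exact Ideal.mul_mem_left _ _ h
  · have h := monomial_mem_pairWt c 3 9 (2 * 3) (2 * 3 * 9) 0 0 9 (by norm_num) (by norm_num)
    have h' : e₃ * c 2 ^ 9 = e₃ * (c 0 ^ 0 * c 1 ^ 0 * c 2 ^ 9) := by ring
    rw [h']; exact Ideal.mul_mem_left _ _ h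

/-- The strict pair tail ideal is contained in the pair member ideal (thresholds one lower).  KERNEL (PROVED). [folklore] -/
theorem pairTail_le_pairWt (c : Fin 4 → R) (m d : ℕ) :
    pairWt c m d (2 * m + 1) (2 * m * d + 1) ≤ pairWt c m d (2 * m) (2 * m * d) := by
  apply Ideal.span_mono
  rintro x ⟨i, a, b, h₁, h₃, rfl⟩
  exact ⟨i, a, b, by omega, by omega, rfl⟩

/-- **THE CORNER MEMBER HAS THE STEEP-PAIR LETTER `(m,d) = (3,9)` AT `y′ ∈ C₁ ∖ C₂`** (ring level, any units — at
`y′ = (0,0,0,1)`: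
`e₁ = x + 2t + 2`, `e₃ = t²`, `l₁ = l₂ = t`).  KERNEL (PROVED). [folklore] -/
theorem corner39_steepPairShape (c : Fin 4 → R) (e₁ e₃ l₁ l₂ : R) (he₁ : IsUnit e₁) (he₃ : IsUnit e₃) :
    SteepPairShape (Ideal.span {c 0 ^ 2 + e₁ * c 1 ^ 3 + e₃ * c 2 ^ 9 +
      (l₁ * (c 1 ^ 2 * c 2 ^ 4) + l₂ * (c 1 ^ 3 * c 2))}) c 3 9 := by
  refine ⟨e₁, e₃, _, he₁, he₃, corner39_tail_mem_pairTail c l₁ l₂, Ideal.subset_span (by simp), ?_⟩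
  rw [Ideal.span_le, Set.singleton_subset_iff]
  exact Ideal.add_mem _ (corner39_terms_mem_pairWt c e₁ e₃)
    (pairTail_le_pairWt c 3 9 (corner39_tail_mem_pairTail c l₁ l₂))

/-- **THE CUMULATIVE CHART OF THE CONE `{v, e_x}`, `v = (3,1,0)`, FOR THE CORNER MEMBER** (`x = u³w`, `y = u`, `z = Z·u⁴`; any
commutative ring): `f = u⁸·(Z² + u·((2t+2)w³ + t²) + u²·(w²t + w³t) + u⁴w⁴)`.  KERNEL (PROVED, `ring`). [folklore] -/
theorem corner39_chart (Z u w t : R) :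
    (Z * u ^ 4) ^ 2 + (u ^ 3 * w + 2 * t + 2) * (u ^ 3 * w) ^ 3 + t ^ 2 * u ^ 9 + (u ^ 3 * w) ^ 2 * u ^ 4 * t +
        (u ^ 3 * w) ^ 3 * u * t =
      u ^ 8 * (Z ^ 2 + u * ((2 * t + 2) * w ^ 3 + t ^ 2) + u ^ 2 * (w ^ 2 * t + w ^ 3 * t) + u ^ 4 * w ^ 4) := by
  ring

/-- **THE INITIAL FORM AT THE BAD POINT `P = (0,0,2,1)` IS `Z²`** (centred coordinates `w = 2 + W`, `t = 1 + T`; any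
ring with `3 = 0`):
the controlled transform equals `Z² + u(T² + W³ + 2TW³) + u²·W(1+T)(2+W)² + u⁴(2+W)⁴` — all monomials but `Z²` of
degree `≥ 3`, so
`ord_P = 2` and `τ(P) = 1`: ODD DOMINATION'S PACKAGE DOES NOT EXIT AT `corner39`.  KERNEL (PROVED,
`linear_combination`). [folklore] -/
theorem corner39_initialForm (h3 : (3 : R) = 0) (Z u W T : R) :
    Z ^ 2 + u * ((2 * (1 + T) + 2) * (2 + W) ^ 3 + (1 + T) ^ 2) + u ^ 2 * ((2 + W) ^ 2 * (1 + T) + (2 + W) ^ 3 * (1 + T)) +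
        u ^ 4 * (2 + W) ^ 4 =
      Z ^ 2 + u * (T ^ 2 + W ^ 3 + 2 * T * W ^ 3) + u ^ 2 * (W * ((1 + T) * (2 + W) ^ 2)) + u ^ 4 * (2 + W) ^ 4 := by
  linear_combination (u * (6 * T + 8 * T * W + 4 * T * W ^ 2 + 11 + 16 * W + 8 * W ^ 2 + W ^ 3) +
    u ^ 2 * ((1 + T) * (2 + W) ^ 2)) * h3

/-- `3 = 0` in every ring of characteristic `3` — `𝔽₃`, `𝔽₃[z,x,y,t]`, the local rings of the corner member (the hypothesis of
`corner39_initialForm`).  KERNEL (PROVED). [folklore] -/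
theorem three_eq_zero_of_charP [CharP R 3] : (3 : R) = 0 := by
  simpa using CharP.cast_eq_zero R 3

end OddCorner

end OddRing

end Summit.ResolutionOfSingularities.ResolutionOfSingularities.Theorems.OddCrossCut
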